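import Literature.AlgebraicGeometry.Hu2025.Statements.S08MainTheorem.R110aSmooth
import Literature.AlgebraicGeometry.Hu2025.Statements.S07GammaSchemes.R109aGamma
import Literature.AlgebraicGeometry.Hu2025.Statements.S03Pluecker.R101aPlatform
import Mathlib.AlgebraicGeometry.Properties
import HarnessLib

/-!
# Hu 2025 (arXiv:2507.21400v1) §8.4 Thm. 8.5 / Thm. 8.6 and §1.6 Thm. 1.3 at SCHEME level — the Γ-scheme `Z_Γ` as a scheme,
# the ℓ-transform tower `Z̃†_{ℓ,Γ} → ⋯ → Z_Γ` (display (8.17)) as a STRUCTURE, the theorems as PROPERTIES OF A GIVEN TOWER, and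
# the CLOSED platform consequences «`Z_Γ` admits a resolution» — row 110 file `d` = `S08MainTheorem/R110dEllTransform.lean`,
# STATEMENTS-FIRST (rung M-Hu-min, D-0089). PRE-DRAFT by res-type-024 (gen 6; v3.1 gen 7: §8's standing hypothesis «𝔽 = ℚ or 𝔽_p»
# made an explicit HYPOTHESIS of every «over Spec 𝔽» statement, PARTITION-HU §6 (c), after the lane-A pre-read 2026-08-27T05:26Z);
# NOT FILED before the 08:00Z line.

**Status of the sources (D-0012): UNREFEREED PREPRINTS UNDER ADJUDICATION.** [Hu25] = Y. Hu, *Universal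
characteristic-free resolution of singularities, I*, arXiv:2507.21400v1 (2025), TeX chunks `p0001…p0073` (locator of
record `chunk p<cc> l.<a>–<b>` = `C<cc>L<l>`, next to it the arXiv-v1 PDF page, cross-checked on the PDF text layer
`lit/res-lit-6/hu25/text`); [Hu22] = Y. Hu, arXiv:2203.03842v4 (2022), locator `p.N l.a–b` = `Hu22P<ppp>L<l>`. Every
statement is typed as a `def … : Prop` CANDIDATE / real definition / STRUCTURE whose fields quote the printed
requirements, tagged `[claim: Hu2025 | Hu2022, status: under-review]`, consumed only as a hypothesis, never asserted; no
decl takes a side. No proofs, no `sorry`, no `instance`, no notation. AI typing is weaker than expert review.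
STATUS: candidate statements under adjudication (D-0012/D-0089); not asserted.

ROW-110 FILE LAYOUT (res-type-024 pre-draft v3, 2026-08-27T05:3xZ; rationale in HOME/plan/tools/res-type-024/hu/README-hu110-bc.md):
a `S08MainTheorem/R110aSmooth` (I-SM: HuSmooth/Def8_4, IsHuResolution, AdmitsResolution/C71L67, AdmitsResolutionType/C03L19,
IsHuBaseField/C67L4, HuSingular(_reg); deps: tree only) · b `S08MainTheorem/R110bMainTheorems` (§8.1 Lem8_1/Def8_2/Lem8_3
+ the CHART content of Thm 8.5; deps: Mathlib only) · c `S01S09Interface/R110cUniversalityInterface` (§9 matroids,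
Prop9_1, Thm9_2/9_3/9_4 over LafforgueObjects; §1 Thm1_1, C09L16, C09L21; [Hu22] Thm1_1, P133L11; deps: a + Mathlib) ·
d `S08MainTheorem/R110dEllTransform` (Z_Γ as a scheme, the ℓ-transform tower STRUCTURE, Thm8_5/Thm8_6/Thm1_3 as
properties of a tower, the CLOSED platform consequences; deps: a + row 109 I-GA + row 101 I-PL) · e
`S01S09Interface/R110eGammaOfMatroid` (Γ_d on the platform, C72L129, Hu22Setup + Hu22P131L40, C09L16_inst; deps: c + d).

THIS FILE (deps: a `R110aSmooth` + row 109's I-GA `S07GammaSchemes.R109aGamma` (`GammaSchemeRing`) + row 101's I-PL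
`S03Pluecker.R101aPlatform` (`plVar`, `primaryFamily`, `HuPlatform`) + Mathlib). Read for it: chunks p0070 (l.70–160), p0071
(whole), p0008 (l.95–121), p0057 (l.9–23); PDF p.156, p.158, p.17, p.128.
1. `Z_Γ` at scheme level = `gammaSpec 𝔉 Γ := Spec (GammaSchemeRing 𝔉 Γ)` with its structure morphism to `Spec 𝔽` (row 109's
   split-v2 I-GA uses the name `S07GammaSchemes.gammaScheme` for the RING alias, hence `gammaSpec` here). «`Z_Γ` is
   integral» = Mathlib `IsIntegral (gammaSpec 𝔉 Γ)`; «singular» = a's `HuSingular` (READING R-sm).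
2. `Z̃_{ℓ,Γ}`, `Z̃†_{ℓ,Γ}` and the sequence (8.17) are CONSTRUCTED IN PRINT (§§5–7; rows 103–109 type that content CHART-WISE)
   but NOT constructed as schemes anywhere in this typing: they are recorded as the STRUCTURE `EllTransformTower 𝔉 Γ` whose
   fields are the printed data, with the docstring line «CONSTRUCTED IN PRINT, NOT CONSTRUCTED IN THIS TYPING; the structure
   does not tie an inhabitant to the printed construction». Thm 8.5 / 8.6 / 1.3 are then PROPERTIES OF A GIVEN TOWER
   (`Thm8_5 h𝔽 T`, `Thm8_6 h𝔽 T`, `Thm1_3 h𝔽 T : Prop`, `h𝔽 : IsHuBaseField 𝔽` = §8's standing hypothesis C67L4 «`𝔽` is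
   `ℚ` or `𝔽_p`», chunk p0067 l.3–8 = chunk p0015 l.22–27 / PDF p.32 L003–L006 «From Section 3 to Section 8 … over the
   perfect field `𝔽`» — an explicit HYPOTHESIS of every statement printed «over `Spec 𝔽`», PARTITION-HU §6 (c), never a
   comment; the bodies do not use it) — the PARAMETRIC rendering used throughout rows 106–109; a `∀ T`-closed form is
   deliberately NOT offered (it would quantify over arbitrary data).
3. The CLOSED consequences that need no tower — what [Hu22] p.131 l.42–45 consumes («We then let `ϖ_Γ : Z̃†_{ℓ,Γ} → Z_Γ` be
   as in Theorem 8.6. This is a resolution.»): `Thm1_3_admitsResolution` (= `Thm8_6_admitsResolution`, the same statement spelled out under the Thm-8.6 locator) : `∀ 𝔽` (Hu base field)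
   `∀ n` (`HuPlatform n`) `∀ Γ ⊆ Var_𝐔`, `Z_Γ` integral ∧ singular ⇒ `AdmitsResolution (Z_Γ → Spec 𝔽)`, with
   `Z_Γ := gammaSpec (primaryFamily n 𝔽) Γ`; ∃-CONSEQUENCES of the printed sentences, labelled.
UNIVERSE NOTE: I-PL's `plVar n : Type` lives in universe `0` and I-GA binds `σ 𝔽 : Type u` in ONE universe, so the CLOSED
statements over the platform are stated for fields `𝔽 : Type` (enough for `ℚ`, `ZMod p`).
-/

noncomputable section

open _root_.CategoryTheory _root_.CategoryTheory.Limits _root_.AlgebraicGeometry _root_.MvPolynomial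

namespace Literature.AlgebraicGeometry.Hu2025.Statements.S08MainTheorem

open Literature.AlgebraicGeometry.Hu2025.Statements.S07GammaSchemes
open Literature.AlgebraicGeometry.Hu2025.Statements.S03Pluecker
open Literature.AlgebraicGeometry.Resolution Literature.AlgebraicGeometry.Morphisms

universe u

/-! ## `Z_Γ` as a scheme over `Spec 𝔽` (Def. 7.1, chunk p0057 l.19–23; p.128 — row 109 gives the ring) -/

section GammaScheme

variable {σ 𝔽 : Type u} [Field 𝔽]

/-- **The Γ-scheme `Z_Γ` at scheme level** (Def. 7.1, chunk p0057 l.19–23; PDF p.128: «We let `Z_Γ (⊂ Gr^{3,E} ∩ 𝐔)` be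
the closed subscheme of the affine space `𝐔` defined by the ideal `I_{℘,Γ}`»): `Spec` of row 109's coordinate ring
`GammaSchemeRing 𝔉 Γ = 𝔽[x_u : u ∈ σ]/I_{℘,Γ}` (I-GA; `σ` = the variable index set `𝕀_{3,n} ∖ m` of row 101, `𝔉` = the
de-homogenised `m`-primary Plücker relations `primaryFamily n 𝔽`). [claim: Hu2025, status: under-review]
STATUS: candidate statement under adjudication (D-0012/D-0089); not asserted. -/
def gammaSpec (𝔉 : Set (MvPolynomial σ 𝔽)) (Γ : Set σ) : Scheme.{u} :=
  Spec (CommRingCat.of (GammaSchemeRing 𝔉 Γ))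

/-- **`Z_Γ → Spec 𝔽`, the structure morphism** (chunk p0070 l.93; p.156: «`Z_Γ` and `Z̃_{ℓ,Γ}` are considered as
`𝔽`-schemes»; §8 preamble C67L4): `Spec` of the algebra map `𝔽 → 𝔽[x]/I_{℘,Γ}`. [claim: Hu2025, status: under-review]
STATUS: candidate statement under adjudication (D-0012/D-0089); not asserted. -/
def gammaSpecToBase (𝔉 : Set (MvPolynomial σ 𝔽)) (Γ : Set σ) :
    gammaSpec 𝔉 Γ ⟶ Spec (CommRingCat.of 𝔽) :=
  Spec.map (CommRingCat.ofHom (algebraMap 𝔽 (GammaSchemeRing 𝔉 Γ)))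

end GammaScheme

/-! ## The objects of Thm 8.5 / 8.6 at scheme level: `Z̃_{ℓ,Γ}`, `Z̃†_{ℓ,Γ}` and the sequence (8.17) — a STRUCTURE -/

/-- **The three kinds of steps in display (8.17) of Thm 8.6** (chunk p0071 l.82–86; PDF p.158), verbatim: «every morphism
`Z̃†_{ħ,Γ} → Z̃†_{ħ',Γ}` in the sequence is `Z̃†_{ϑ[k],Γ} → Z̃†_{ϑ[k−1],Γ}` for some `k ∈ [Υ]`, or
`Z̃†_{(℘_(kτ) 𝔯_μ 𝔰_h),Γ} → Z̃†_{(℘_(kτ) 𝔯_μ 𝔰_{h−1}),Γ}` for some `(kτ)μh ∈ Index_{Φ_k}`, or `Z̃†_{ℓ_k,Γ} → Z̃†_{℘_k}`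
for some `k ∈ [Υ]`.» — together with the 𝔉-steps `Z†_{𝔉[j],Γ} → Z†_{𝔉[j−1],Γ}` of the display (chunk p0071 l.79). The
LABEL of a step only (the indices `k`, `(kτ)μh`, `j` as naturals); what the step IS (the Γ-restricted blow-up of rows
106–109) is not recorded by the label. [claim: Hu2025, status: under-review]
STATUS: candidate statement under adjudication (D-0012/D-0089); not asserted. -/
inductive TowerStepKind
  /-- `Z†_{𝔉[j],Γ} → Z†_{𝔉[j−1],Γ}` (§7.2 𝔉-transforms, Lem. 7.3) -/
  | frak (j : ℕ)
  /-- `Z̃†_{ϑ[k],Γ} → Z̃†_{ϑ[k−1],Γ}` (ϑ-transforms, Lem. 7.4) -/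
  | theta (k : ℕ)
  /-- `Z̃†_{(℘_(kτ) 𝔯_μ 𝔰_h),Γ} → Z̃†_{(℘_(kτ) 𝔯_μ 𝔰_{h−1}),Γ}` (℘-transforms, Lem. 7.5) -/
  | wp (k τ μ h : ℕ)
  /-- `Z̃†_{ℓ_k,Γ} → Z̃†_{℘_k}` (ℓ-transforms, Lem. 7.5 / Cor. 7.6) -/
  | ell (k : ℕ)

section Tower

variable {σ 𝔽 : Type u} [Field 𝔽]

/-- **The ℓ-transform tower of `Z_Γ` at scheme level — the objects Thm 8.5 / Thm 8.6 / Thm 1.3 speak about**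
(Thm 8.5 chunk p0070 l.78–87, p.156: «Let `Z̃_{ℓ,Γ}` be the ℓ-transform of `Z_Γ` in `𝒱̃_ℓ` … `Z̃†_{ℓ,Γ}`»; Thm 8.6
chunk p0071 l.71–87, p.158: «the morphism `Z̃†_{ℓ,Γ} → Z_Γ` can be decomposed as `Z̃†_{ϱ,Γ} → ⋯ → Z̃†_{ħ,Γ} → Z̃†_{ħ',Γ}
→ ⋯ → Z†_{𝔉[j],Γ} → Z†_{𝔉[j−1],Γ} → ⋯ → Z_Γ`»). **CONSTRUCTED IN PRINT (§§5–7: ℛ ← ℛ̃_{ϑ} ← ℛ̃_{℘…} ← ℛ̃_ℓ, the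
𝔉-, ϑ-, ℘- and ℓ-transforms of `Z_Γ` and their irreducible components `Z̃†`, Lem. 7.3–7.5, Cor. 7.6 — typed CHART-WISE by rows
103–109), NOT CONSTRUCTED IN THIS TYPING: the structure records the printed DATA only and does NOT tie an inhabitant to
the printed construction (no scheme-level blow-up tower is built in M-Hu-min).** Fields: the number `len` of arrows of
the display; the stages `stage i` (`i = 0, …, len`), `stage 0 ≅ Z_Γ = gammaSpec 𝔉 Γ`, `stage len = Z̃†_{ℓ,Γ}`; the
arrows `step i : stage (i+1) ⟶ stage i` with their printed labels `kind i`; the scheme `Z̃_{ℓ,Γ}` with the closed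
immersion `Z̃†_{ℓ,Γ} ↪ Z̃_{ℓ,Γ}` («irreducible component», Lem. 7.5 second bullet) and its structure morphism to
`Spec 𝔽`, compatible with `Z_Γ → Spec 𝔽` along the tower. Consumers: `Thm8_5`, `Thm8_6`, `Thm1_3` (properties OF a
tower). [claim: Hu2025, status: under-review]
STATUS: candidate statement under adjudication (D-0012/D-0089); not asserted. -/
structure EllTransformTower (𝔉 : Set (MvPolynomial σ 𝔽)) (Γ : Set σ) where
  /-- number of arrows in display (8.17) of Thm 8.6 -/
  len : ℕ
  /-- the stages: `stage 0 = Z_Γ`, …, `stage len = Z̃†_{ℓ,Γ}` (read from the right of the display) -/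
  stage : Fin (len + 1) → Scheme.{u}
  /-- the arrows `Z̃†_{ħ,Γ} → Z̃†_{ħ',Γ}` of the display -/
  step : ∀ i : Fin len, stage i.succ ⟶ stage i.castSucc
  /-- the printed label of each arrow (𝔉-, ϑ-, ℘- or ℓ-step; Thm 8.6, chunk p0071 l.82–86) -/
  kind : Fin len → TowerStepKind
  /-- `stage 0` is `Z_Γ` -/
  stageZeroIso : stage 0 ≅ gammaSpec 𝔉 Γ
  /-- `Z̃_{ℓ,Γ}`, «the ℓ-transform of `Z_Γ` in `𝒱̃_ℓ`» (Thm 8.5, chunk p0070 l.81) -/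
  ellTransform : Scheme.{u}
  /-- `Z̃†_{ℓ,Γ} ↪ Z̃_{ℓ,Γ}` -/
  daggerIncl : stage (Fin.last len) ⟶ ellTransform
  /-- «comes equipped with an irreducible component `Z̃†`» — a closed immersion -/
  daggerIncl_isClosedImmersion : IsClosedImmersion daggerIncl
  /-- `Z̃_{ℓ,Γ} → Spec 𝔽` («considered as `𝔽`-schemes», chunk p0070 l.93) -/
  ellToBase : ellTransform ⟶ Spec (CommRingCat.of 𝔽)
  /-- `Z̃†_{ℓ,Γ} → Spec 𝔽` -/
  daggerToBase : stage (Fin.last len) ⟶ Spec (CommRingCat.of 𝔽)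
  /-- compatibility `Z̃†_{ℓ,Γ} ↪ Z̃_{ℓ,Γ} → Spec 𝔽` -/
  daggerToBase_eq : daggerIncl ≫ ellToBase = daggerToBase
  /-- every stage is an `𝔽`-scheme … -/
  stageToBase : ∀ i : Fin (len + 1), stage i ⟶ Spec (CommRingCat.of 𝔽)
  /-- … `Z_Γ` with its own structure morphism … -/
  stageToBase_zero : stageToBase 0 = stageZeroIso.hom ≫ gammaSpecToBase 𝔉 Γ
  /-- … the top one being `Z̃†_{ℓ,Γ} → Spec 𝔽` … -/
  stageToBase_last : stageToBase (Fin.last len) = daggerToBase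
  /-- … and the arrows are `𝔽`-morphisms -/
  step_comm : ∀ i : Fin len, step i ≫ stageToBase i.castSucc = stageToBase i.succ

namespace EllTransformTower

variable {𝔉 : Set (MvPolynomial σ 𝔽)} {Γ : Set σ}

/-- The composite `Z̃†_{ℓ,Γ} = stage len → ⋯ → stage i` of the display (8.17) down to stage `i` (auxiliary; used for
«the morphism `Z̃†_{ℓ,Γ} → Z_Γ`», Thm 8.6 chunk p0071 l.73–74). [claim: Hu2025, status: under-review]
STATUS: candidate statement under adjudication (D-0012/D-0089); not asserted. -/
def downTo (T : EllTransformTower 𝔉 Γ) : ∀ i : Fin (T.len + 1), T.stage (Fin.last T.len) ⟶ T.stage i :=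
  Fin.reverseInduction (𝟙 _) fun i f => f ≫ T.step i

/-- **«the morphism `Z̃†_{ℓ,Γ} → Z_Γ`»** (Thm 8.6, chunk p0071 l.73–74; Thm 1.3 chunk p0008 l.115 «the induced morphism
`Z̃†_{ℓ,Γ} → Z_Γ`»): the composite of the whole display followed by `stage 0 ≅ Z_Γ`.
[claim: Hu2025, status: under-review]
STATUS: candidate statement under adjudication (D-0012/D-0089); not asserted. -/
def toGammaScheme (T : EllTransformTower 𝔉 Γ) : T.stage (Fin.last T.len) ⟶ gammaSpec 𝔉 Γ :=
  T.downTo 0 ≫ T.stageZeroIso.hom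

end EllTransformTower

end Tower

/-! ## Thm 8.5 (chunk p0070 l.78–87; PDF p.156 L006–L012) -/

/-- **Hu 2025, Theorem 8.5** (chunk p0070 l.78–87; PDF p.156), verbatim: «Let `Γ` be any subset `Var_𝐔`. Assume that `Z_Γ`
is integral. Let `Z̃_{ℓ,Γ}` be the ℓ-transform of `Z_Γ` in `𝒱̃_ℓ`. Then, `Z̃_{ℓ,Γ}` is smooth over `Spec 𝔽`.
Consequently, `Z̃†_{ℓ,Γ}` is smooth over `Spec 𝔽`. In particular, when `Γ = ∅`, we obtain that `𝒱̃_ℓ` is smooth over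
`Spec 𝔽`.» As a PROPERTY OF A GIVEN TOWER `T` (module docstring, item 3): `Z_Γ` integral (Mathlib `IsIntegral`) ⇒
`Z̃_{ℓ,Γ} → Spec 𝔽` and `Z̃†_{ℓ,Γ} → Spec 𝔽` are smooth in the sense of Def. 8.4 (I-SM `HuSmooth`, AS PRINTED; the
Mathlib-idiom sibling is `Thm8_5_ours`; the CHART content of the proof is file b's `Thm8_5_chart`). The «In particular, `Γ = ∅`» clause is the instance `Γ := ∅` (chunk p0071 l.3–5:
«`Z_∅ = 𝐔 ∩ Gr^{3,E}` and `Z̃_{ℓ,∅} = 𝒱̃_ℓ`»), not a separate decl. «over `Spec 𝔽`»: `𝔽` is the base field of §8's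
standing hypothesis (chunk p0067 l.3–8, PDF p.147 L048–L050: «Let `𝔽` be either `ℚ` or a finite field with `p` elements. In
this entire section, every scheme … is considered as a scheme over the perfect field `𝔽`»; already chunk p0015 l.22–27 =
PDF p.32 L003–L006 for §§3–8) — the explicit HYPOTHESIS `_h𝔽 : IsHuBaseField 𝔽` (a's `C67L4`; PARTITION-HU §6 (c): a
hypothesis, never a comment; the body does not use it), exactly as in `Thm1_3`.
[claim: Hu2025, status: under-review]
STATUS: candidate statement under adjudication (D-0012/D-0089); not asserted. -/
def Thm8_5 {σ 𝔽 : Type u} [Field 𝔽] (_h𝔽 : IsHuBaseField 𝔽) {𝔉 : Set (MvPolynomial σ 𝔽)} {Γ : Set σ}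
    (T : EllTransformTower 𝔉 Γ) : Prop :=
  IsIntegral (gammaSpec 𝔉 Γ) → HuSmooth T.ellToBase ∧ HuSmooth T.daggerToBase

/-- **Thm 8.5 in Mathlib's idiom** (sibling of `Thm8_5`, same locator): `Smooth (Z̃_{ℓ,Γ} → Spec 𝔽)` and
`Smooth (Z̃†_{ℓ,Γ} → Spec 𝔽)` with finitely many connected components (`HuSmooth_ours`), under the same explicit base-field
hypothesis `_h𝔽 : IsHuBaseField 𝔽` (§8 preamble C67L4; PARTITION-HU §6 (c)). OURS phrasing, labelled.
[claim: Hu2025, status: under-review]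
STATUS: candidate statement under adjudication (D-0012/D-0089); not asserted. -/
def Thm8_5_ours {σ 𝔽 : Type u} [Field 𝔽] (_h𝔽 : IsHuBaseField 𝔽) {𝔉 : Set (MvPolynomial σ 𝔽)} {Γ : Set σ}
    (T : EllTransformTower 𝔉 Γ) : Prop :=
  IsIntegral (gammaSpec 𝔉 Γ) → HuSmooth_ours T.ellToBase ∧ HuSmooth_ours T.daggerToBase

/-! ## Thm 8.6 (chunk p0071 l.71–89; PDF p.158 L025–L047; display = eq. (8.17)) -/

/-- **Hu 2025, Theorem 8.6** (chunk p0071 l.71–89; PDF p.158), verbatim: «Let `Γ` be any subset `Var_𝐔`. Assume that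
`Z_Γ` is integral. Then, the morphism `Z̃†_{ℓ,Γ} → Z_Γ` can be decomposed as `Z̃†_{ϱ,Γ} → ⋯ → Z̃†_{ħ,Γ} → Z̃†_{ħ',Γ} → ⋯
→ Z†_{𝔉[j],Γ} → Z†_{𝔉[j−1],Γ} → ⋯ → Z_Γ` such that every morphism `Z̃†_{ħ,Γ} → Z̃†_{ħ',Γ}` in the sequence is [a ϑ-,
℘- or ℓ-step]. Further, every morphism in the sequence is surjective, projective, and birational. In particular,
`Z̃†_{ℓ,Γ} → Z_Γ` is a resolution if `Z_Γ` is singular.» As a PROPERTY OF A GIVEN TOWER `T` (the decomposition itself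
IS the datum `T`; module docstring item 3): `Z_Γ` integral ⇒ every arrow `T.step i` is surjective (Mathlib
`Surjective`), projective (tree `Morphisms.IsProjective`, Hartshorne II §4) and birational (tree
`Resolution.IsBirational`), AND («In particular») if `Z_Γ → Spec 𝔽` is singular (READING R-sm) then
`Z̃†_{ℓ,Γ} → Z_Γ` is a resolution in the sense of p.158 L021–L024 (I-SM `IsHuResolution`: source Hu-smooth over
`Spec 𝔽`, projective, birational, onto). The base field `𝔽` of «resolution»/«singular» (Hu-smooth over `Spec 𝔽`,
a's `IsHuResolution` / `HuSingular`) is the one of §8's standing hypothesis (chunk p0067 l.3–8; chunk p0015 l.22–27 =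
PDF p.32 L003–L006) — the explicit HYPOTHESIS `_h𝔽 : IsHuBaseField 𝔽` (C67L4; PARTITION-HU §6 (c); the body does
not use it), as in `Thm8_5` / `Thm1_3`. [claim: Hu2025, status: under-review]
STATUS: candidate statement under adjudication (D-0012/D-0089); not asserted. -/
def Thm8_6 {σ 𝔽 : Type u} [Field 𝔽] (_h𝔽 : IsHuBaseField 𝔽) {𝔉 : Set (MvPolynomial σ 𝔽)} {Γ : Set σ}
    (T : EllTransformTower 𝔉 Γ) : Prop :=
  IsIntegral (gammaSpec 𝔉 Γ) →
    (∀ i : Fin T.len, _root_.AlgebraicGeometry.Surjective (T.step i) ∧ IsProjective (T.step i) ∧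
        IsBirational (T.step i)) ∧
      (HuSingular (gammaSpecToBase 𝔉 Γ) → IsHuResolution T.toGammaScheme (gammaSpecToBase 𝔉 Γ))

/-! ## Thm 1.3 (chunk p0008 l.106–116; PDF p.17 L009–L015) -/

/-- **Hu 2025, Theorem 1.3 (Universal characteristic-free resolution of singularity types)** (chunk p0008 l.106–116;
PDF p.17), verbatim: «Let `𝔽` be either `ℚ` or a finite field with `p` elements where `p` is a prime number. Let `Γ`
be any subset of `Var_𝐔`. Assume that `Z_Γ` is integral. Let `Z̃_{ℓ,Γ}` be the ℓ-transform of `Z_Γ` in `𝒱̃_ℓ`. Then,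
`Z̃_{ℓ,Γ}` is smooth over `𝔽`. In particular, the induced morphism `Z̃†_{ℓ,Γ} → Z_Γ` is a resolution over `𝔽`, provided
that `Z_Γ` is singular.» As a PROPERTY OF A GIVEN TOWER `T` over a Hu base field (`IsHuBaseField 𝔽`, the printed first
sentence): `Z_Γ` integral ⇒ `Z̃_{ℓ,Γ} → Spec 𝔽` Hu-smooth, and (`Z_Γ` singular ⇒ `Z̃†_{ℓ,Γ} → Z_Γ` is a resolution,
`IsHuResolution`). The text itself: «= Theorem 8.5 + Theorem 8.6» (chunk p0008 l.118–119).
[claim: Hu2025, status: under-review]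
STATUS: candidate statement under adjudication (D-0012/D-0089); not asserted. -/
def Thm1_3 {σ 𝔽 : Type u} [Field 𝔽] (_h𝔽 : IsHuBaseField 𝔽) {𝔉 : Set (MvPolynomial σ 𝔽)} {Γ : Set σ}
    (T : EllTransformTower 𝔉 Γ) : Prop :=
  IsIntegral (gammaSpec 𝔉 Γ) →
    HuSmooth T.ellToBase ∧
      (HuSingular (gammaSpecToBase 𝔉 Γ) → IsHuResolution T.toGammaScheme (gammaSpecToBase 𝔉 Γ))

/-! ## The CLOSED consequences over row 101's platform (no tower): «`Z_Γ` admits a resolution» -/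

/-- **Thm 1.3 «In particular …» ⇒ «`Z_Γ` admits a resolution» — CLOSED form over the platform of row 101** (Thm 1.3
chunk p0008 l.115–116, p.17: «the induced morphism `Z̃†_{ℓ,Γ} → Z_Γ` is a resolution over `𝔽`, provided that `Z_Γ` is
singular»; p.158 L021–L024 = I-SM `AdmitsResolution`; this is the form in which [Hu22] p.131 l.42–45 consumes Thm 8.6:
«We then let `ϖ_Γ : Z̃†_{ℓ,Γ} → Z_Γ` be as in Theorem 8.6. This is a resolution.»). For every field `𝔽` with
`IsHuBaseField 𝔽`, every `n` with row 101's standing data `HuPlatform n`, and every `Γ ⊆ Var_𝐔` (Def. 7.1: a set of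
chart-variable indices, `Set (plVar n)`): if `Z_Γ := gammaSpec (primaryFamily n 𝔽) Γ` is integral and
`Z_Γ → Spec 𝔽` is singular (READING R-sm), then `Z_Γ → Spec 𝔽` admits a resolution (`AdmitsResolution`). An
∃-CONSEQUENCE of the printed sentence (the print names THE morphism), labelled; universe `0` (module docstring,
UNIVERSE NOTE). [claim: Hu2025, status: under-review]
STATUS: candidate statement under adjudication (D-0012/D-0089); not asserted. -/
def Thm1_3_admitsResolution : Prop :=
  ∀ (𝔽 : Type) [Field 𝔽], IsHuBaseField 𝔽 → ∀ n : ℕ, HuPlatform n → ∀ Γ : Set (plVar n),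
    IsIntegral (gammaSpec (primaryFamily n 𝔽) Γ) →
      HuSingular (gammaSpecToBase (primaryFamily n 𝔽) Γ) →
        AdmitsResolution (gammaSpecToBase (primaryFamily n 𝔽) Γ)

/-- **Thm 8.6 «In particular, `Z̃†_{ℓ,Γ} → Z_Γ` is a resolution if `Z_Γ` is singular» ⇒ «`Z_Γ` admits a resolution» —
CLOSED form over the platform** (chunk p0071 l.88–89; PDF p.158). With §8's standing hypothesis «`𝔽` is `ℚ` or `𝔽_p`»
(chunk p0067 l.3–8; chunk p0015 l.22–27 = PDF p.32 L003–L006) made explicit as `IsHuBaseField 𝔽` (PARTITION-HU §6 (c)),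
this closed ∃-CONSEQUENCE is LITERALLY the one of Thm 1.3's «In particular» clause, `Thm1_3_admitsResolution` (the text
itself: Theorem 1.3 «= Theorem 8.5 + Theorem 8.6», chunk p0008 l.118–119; PDF p.17) — the SAME statement SPELLED OUT a
second time under the Thm-8.6 locator (definitionally equal to `Thm1_3_admitsResolution`; the print states the clause twice);
labelled. [claim: Hu2025, status: under-review]
STATUS: candidate statement under adjudication (D-0012/D-0089); not asserted. -/
def Thm8_6_admitsResolution : Prop :=
  ∀ (𝔽 : Type) [Field 𝔽], IsHuBaseField 𝔽 → ∀ n : ℕ, HuPlatform n → ∀ Γ : Set (plVar n),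
    IsIntegral (gammaSpec (primaryFamily n 𝔽) Γ) →
      HuSingular (gammaSpecToBase (primaryFamily n 𝔽) Γ) →
        AdmitsResolution (gammaSpecToBase (primaryFamily n 𝔽) Γ)

/-- **Thm 8.5 «In particular, when `Γ = ∅` … `𝒱̃_ℓ` is smooth over `Spec 𝔽`» combined with Thm 8.6 at `Γ = ∅` ⇒
«`𝐔 ∩ Gr^{3,E}` admits a resolution or is smooth» — CLOSED form over the platform** (chunk p0070 l.86–87, chunk p0071
l.3–5 «`Z_∅ = 𝐔 ∩ Gr^{3,E}` and `Z̃_{ℓ,∅} = 𝒱̃_ℓ`»; p.156, p.158): for every field `𝔽` with `IsHuBaseField 𝔽` (§8's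
standing hypothesis C67L4, chunk p0067 l.3–8, explicit per PARTITION-HU §6 (c)), every `n` with `HuPlatform n`:
`Z_∅` integral ⇒ (`Z_∅ → Spec 𝔽` smooth) ∨ `AdmitsResolution (Z_∅ → Spec 𝔽)`. A weak closed CONSEQUENCE recorded for
the vacuity checks of the lanes (the chart `𝐔 ∩ Gr^{3,E}` of the Grassmannian is smooth, so the content is in the first
disjunct's failure being impossible — not asserted). [claim: Hu2025, status: under-review]
STATUS: candidate statement under adjudication (D-0012/D-0089); not asserted. -/
def Thm8_5_8_6_empty : Prop :=
  ∀ (𝔽 : Type) [Field 𝔽], IsHuBaseField 𝔽 → ∀ n : ℕ, HuPlatform n →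
    IsIntegral (gammaSpec (primaryFamily n 𝔽) (∅ : Set (plVar n))) →
      _root_.AlgebraicGeometry.Smooth (gammaSpecToBase (primaryFamily n 𝔽) (∅ : Set (plVar n))) ∨
        AdmitsResolution (gammaSpecToBase (primaryFamily n 𝔽) (∅ : Set (plVar n)))

end Literature.AlgebraicGeometry.Hu2025.Statements.S08MainTheorem

end
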